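import Summits.ValiantsHypothesis.ValiantsHypothesis.Theses.RealTau
import Literature.Computability.AlgebraicComplexity.RealTauKnownCases

/-!
# Crux `RealTau.RealTauRefined` (stmt-ValiantsHypothesis-18101), line `fischer-powers` —
# the Waring-on-the-monomial-curve normal form for `K ≤ 2` powers (calibration stub)

The open core of the line is `WaringOnCurve`: a nonzero signed sum `G = Σ_{i<K} ε_i h_i^m` of
`m`-th powers of `K` real linear forms `h_i = Σ_l c_il X^(e_l)` in common monomials has at most
`2^(a(m+1)) (K+T+2)^a` distinct real zeros for one absolute `a`.  This file settles the rung
`K ≤ 2`, uniformly in `m` and in the exponents `e`: such a `G` has at most `8T` distinct real zeros.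
Reason (roots of unity over `ℝ`): for `K = 2` a real zero `x` of `ε₀ p^m + ε₁ q^m` satisfies
`p(x)^m = ∓ q(x)^m`, hence `p(x) = ± q(x)` or `p(x) = q(x) = 0` according to the signs and the
parity of `m`; so the zeros of `G ≠ 0` lie among those of the nonzero members of
`{p, q, p + q, p - q}`, four linear forms in the same `T` monomials, each with `≤ 2T - 1` zeros by
Descartes' rule (tree `card_roots_toFinset_le_of_card_support`).  `K ≤ 1` is immediate.
The first open rung of the line is therefore `K = 3` (uniformity in `K` is the whole difficulty:
Koiran–Portier–Tavenas 2015, Thm. 12 gives `T^{O(K³)}` for every fixed `K`).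
-/

noncomputable section

-- single-conjunct layout: Sub = Summit, duplicated namespace component intended
set_option linter.dupNamespace false

namespace Summit.ValiantsHypothesis.ValiantsHypothesis.Theorems.RealTauRealTauRefined

open Polynomial Finset
open Literature.Computability.AlgebraicComplexity

/-- A linear form in `T` monomials has at most `T` monomials. [folklore] -/
theorem card_support_linForm_le {T : ℕ} (d : Fin T → ℝ) (e : Fin T → ℕ) :
    (∑ l, C (d l) * X ^ (e l)).support.card ≤ T := by
  have h1 : (∑ l, C (d l) * X ^ (e l)).support.card ≤ ∑ l, (C (d l) * X ^ (e l)).support.card :=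
    card_support_sum_le univ (fun l => C (d l) * X ^ (e l))
  have h2 : ∑ l, (C (d l) * X ^ (e l)).support.card ≤ ∑ _l : Fin T, 1 :=
    sum_le_sum fun l _ => (card_support_C_mul_X_pow_le_one (c := d l) (n := e l))
  have h3 : ∑ _l : Fin T, (1 : ℕ) = T := by
    rw [sum_const, card_univ, Fintype.card_fin, smul_eq_mul, mul_one]
  omega

/-- A linear form in `T` monomials has at most `2T` distinct real zeros (Descartes; `≤ 2T - 1` if it
is nonzero, none counted if it is zero since `roots 0 = 0`). [folklore] -/
theorem card_roots_linForm_le {T : ℕ} (d : Fin T → ℝ) (e : Fin T → ℕ) :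
    (∑ l, C (d l) * X ^ (e l)).roots.toFinset.card ≤ 2 * T := by
  by_cases h0 : (∑ l, C (d l) * X ^ (e l)) = 0
  · rw [h0, roots_zero, Multiset.toFinset_zero, card_empty]; exact Nat.zero_le _
  · have h1 := card_roots_toFinset_le_of_card_support h0
    have h2 := card_support_linForm_le d e
    have h3 : 0 < (∑ l, C (d l) * X ^ (e l)).support.card :=
      card_pos.mpr (nonempty_iff_ne_empty.mpr (mt support_eq_empty.mp h0))
    omega

/-- Real `m`-th roots of unity, sign/parity bookkeeping: if `s₀ a^m + s₁ b^m = 0` with signs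
`s₀, s₁ = ±1` and `m ≠ 0`, then `a = b = 0`, or `a + b = 0`, or (`a - b = 0` with opposite signs).
More precisely, in the form used below. [folklore] -/
theorem sign_pow_add_sign_pow_eq_zero {a b s₀ s₁ : ℝ} {m : ℕ} (hm : m ≠ 0)
    (hs₀ : s₀ = 1 ∨ s₀ = -1) (hs₁ : s₁ = 1 ∨ s₁ = -1) (h : s₀ * a ^ m + s₁ * b ^ m = 0) :
    (s₀ = s₁ ∧ Even m ∧ a = 0 ∧ b = 0) ∨ (s₀ = s₁ ∧ Odd m ∧ a + b = 0) ∨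
      (s₀ = -s₁ ∧ a - b = 0) ∨ (s₀ = -s₁ ∧ Even m ∧ a + b = 0) := by
  by_cases hss : s₀ = s₁
  · subst hss
    have hab : a ^ m + b ^ m = 0 := by
      rcases hs₀ with rfl | rfl <;> linarith
    rcases Nat.even_or_odd m with he | ho
    · left
      have ha : 0 ≤ a ^ m := he.pow_nonneg a
      have hb : 0 ≤ b ^ m := he.pow_nonneg b
      have ha0 : a ^ m = 0 := by linarith
      have hb0 : b ^ m = 0 := by linarith
      exact ⟨rfl, he, pow_eq_zero_iff hm |>.mp ha0, pow_eq_zero_iff hm |>.mp hb0⟩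
    · right; left
      have hab' : a ^ m = (-b) ^ m := by rw [ho.neg_pow]; linarith
      rcases (pow_eq_pow_iff_of_ne_zero hm).mp hab' with h1 | ⟨h1, he⟩
      · exact ⟨rfl, ho, by linarith⟩
      · exact absurd he (Nat.not_even_iff_odd.mpr ho)
  · have hneg : s₀ = -s₁ := by
      rcases hs₀ with rfl | rfl <;> rcases hs₁ with rfl | rfl <;>
        first | exact absurd rfl hss | norm_num
    have hab : a ^ m = b ^ m := by
      subst hneg
      rcases hs₁ with rfl | rfl <;> linarith
    rcases (pow_eq_pow_iff_of_ne_zero hm).mp hab with h1 | ⟨h1, he⟩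
    · right; right; left
      exact ⟨hneg, by linarith⟩
    · right; right; right
      exact ⟨hneg, he, by linarith⟩

/-- **Registered stub `stub_waringSmallK` of line `fischer-powers` (the rung `K ≤ 2` of
`WaringOnCurve`).**  For `K ≤ 2` signs `ε_i = ±1`, a real coefficient matrix `c : K × T` and
exponents `e` (monotonicity is part of the registered shape but not used), the polynomial
`G = Σ_{i<K} ε_i (Σ_l c_il X^(e_l))^m`, if nonzero, has at most `8T` distinct real zeros — for every
`m`.  (`K = 2`: real roots of unity put the zeros of `G` among those of `p, q, p+q, p-q`;
`K ≤ 1`: zeros of `h^m` are those of `h`.) [folklore; cf. Tavenas2014 Conj. 3.24, KoiranPortierTavenas2015 Thm. 12] -/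
theorem stub_waringSmallK :
    ∀ (K m T : ℕ) (ε : Fin K → ℤˣ) (c : Fin K → Fin T → ℝ) (e : Fin T → ℕ), K ≤ 2 → StrictMono e →
      (∑ i, C (((ε i : ℤ) : ℝ)) * (∑ l, C (c i l) * X ^ (e l)) ^ m) ≠ 0 →
        (∑ i, C (((ε i : ℤ) : ℝ)) * (∑ l, C (c i l) * X ^ (e l)) ^ m).roots.toFinset.card ≤ 8 * T := by
  intro K m T ε c e hK _he hG
  -- `m = 0`: `G` is a constant
  rcases Nat.eq_zero_or_pos m with rfl | hm
  · have hconst : (∑ i, C (((ε i : ℤ) : ℝ)) * (∑ l, C (c i l) * X ^ (e l)) ^ 0) =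
        C (∑ i, (((ε i : ℤ) : ℝ))) := by
      simp only [pow_zero, mul_one, map_sum]
    rw [hconst, roots_C, Multiset.toFinset_zero, card_empty]
    exact Nat.zero_le _
  have hm0 : m ≠ 0 := Nat.pos_iff_ne_zero.mp hm
  -- `K = 0, 1, 2`
  obtain rfl | rfl | rfl : K = 0 ∨ K = 1 ∨ K = 2 := by omega
  · -- `K = 0`: `G = 0`
    simp at hG
  · -- `K = 1`: zeros of `ε h^m` are zeros of `h`
    set p : ℝ[X] := ∑ l, C (c 0 l) * X ^ (e l) with hp
    have hG1 : (∑ i : Fin 1, C (((ε i : ℤ) : ℝ)) * (∑ l, C (c i l) * X ^ (e l)) ^ m) =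
        C (((ε 0 : ℤ) : ℝ)) * p ^ m := by
      rw [Fin.sum_univ_one]
    have hs : (((ε 0 : ℤ) : ℝ)) ≠ 0 := by
      rcases Int.units_eq_one_or (ε 0) with h | h <;> simp [h]
    rw [hG1, roots_C_mul _ hs, roots_pow, Multiset.toFinset_nsmul _ _ hm0]
    exact (card_roots_linForm_le (c 0) e).trans (by omega)
  · -- `K = 2`
    set p : ℝ[X] := ∑ l, C (c 0 l) * X ^ (e l) with hp
    set q : ℝ[X] := ∑ l, C (c 1 l) * X ^ (e l) with hq
    set s₀ : ℝ := ((ε 0 : ℤ) : ℝ) with hs₀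
    set s₁ : ℝ := ((ε 1 : ℤ) : ℝ) with hs₁
    have hG2 : (∑ i : Fin 2, C (((ε i : ℤ) : ℝ)) * (∑ l, C (c i l) * X ^ (e l)) ^ m) =
        C s₀ * p ^ m + C s₁ * q ^ m := by
      rw [Fin.sum_univ_two]
    rw [hG2] at hG ⊢
    have hs₀' : s₀ = 1 ∨ s₀ = -1 := by
      rcases Int.units_eq_one_or (ε 0) with h | h <;> simp [hs₀, h]
    have hs₁' : s₁ = 1 ∨ s₁ = -1 := by
      rcases Int.units_eq_one_or (ε 1) with h | h <;> simp [hs₁, h]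
    -- the four auxiliary linear forms and their zero counts
    have hadd : p + q = ∑ l, C (c 0 l + c 1 l) * X ^ (e l) := by
      rw [hp, hq, ← sum_add_distrib]
      refine sum_congr rfl fun l _ => ?_
      rw [C_add, add_mul]
    have hsub : p - q = ∑ l, C (c 0 l - c 1 l) * X ^ (e l) := by
      rw [hp, hq, ← sum_sub_distrib]
      refine sum_congr rfl fun l _ => ?_
      rw [C_sub, sub_mul]
    have bp : p.roots.toFinset.card ≤ 2 * T := card_roots_linForm_le (c 0) e
    have bq : q.roots.toFinset.card ≤ 2 * T := card_roots_linForm_le (c 1) e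
    have badd : (p + q).roots.toFinset.card ≤ 2 * T := by
      rw [hadd]; exact card_roots_linForm_le _ e
    have bsub : (p - q).roots.toFinset.card ≤ 2 * T := by
      rw [hsub]; exact card_roots_linForm_le _ e
    -- containment of the zero set
    have hcont : (C s₀ * p ^ m + C s₁ * q ^ m).roots.toFinset ⊆
        p.roots.toFinset ∪ q.roots.toFinset ∪ (p + q).roots.toFinset ∪ (p - q).roots.toFinset := by
      intro x hx
      rw [Multiset.mem_toFinset, mem_roots', IsRoot.def, eval_add, eval_mul, eval_mul, eval_C, eval_C,
        eval_pow, eval_pow] at hx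
      obtain ⟨-, hx⟩ := hx
      simp only [mem_union, Multiset.mem_toFinset, mem_roots', IsRoot.def, eval_add, eval_sub]
      rcases sign_pow_add_sign_pow_eq_zero hm0 hs₀' hs₁' hx with
        ⟨hss, he, ha, hb⟩ | ⟨hss, ho, hab⟩ | ⟨hss, hab⟩ | ⟨hss, he, hab⟩
      · -- equal signs, `m` even: `p x = q x = 0`
        by_cases hp0 : p = 0
        · -- then `G = C s₁ * q^m`, so `q ≠ 0`
          have hq0 : q ≠ 0 := by
            intro hq0; apply hG; rw [hp0, hq0, zero_pow hm0]; simp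
          exact Or.inl (Or.inl (Or.inr ⟨hq0, hb⟩))
        · exact Or.inl (Or.inl (Or.inl ⟨hp0, ha⟩))
      · -- equal signs, `m` odd: `p x + q x = 0`
        by_cases hpq : p + q = 0
        · exfalso; apply hG
          have hq' : q = -p := by linear_combination hpq
          rw [hq', ho.neg_pow, hss]; ring
        · exact Or.inl (Or.inr ⟨hpq, hab⟩)
      · -- opposite signs: `p x - q x = 0`
        by_cases hpq : p - q = 0
        · exfalso; apply hG
          have hq' : q = p := by linear_combination -hpq
          rw [hq', hss]; simp
        · exact Or.inr ⟨hpq, hab⟩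
      · -- opposite signs, `m` even: `p x + q x = 0`
        by_cases hpq : p + q = 0
        · exfalso; apply hG
          have hq' : q = -p := by linear_combination hpq
          rw [hq', he.neg_pow, hss]; simp
        · exact Or.inl (Or.inr ⟨hpq, hab⟩)
    calc (C s₀ * p ^ m + C s₁ * q ^ m).roots.toFinset.card
        ≤ (p.roots.toFinset ∪ q.roots.toFinset ∪ (p + q).roots.toFinset ∪
            (p - q).roots.toFinset).card := card_le_card hcont
      _ ≤ p.roots.toFinset.card + q.roots.toFinset.card + (p + q).roots.toFinset.card +
            (p - q).roots.toFinset.card :=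
          (card_union_le _ _).trans (Nat.add_le_add_right ((card_union_le _ _).trans
            (Nat.add_le_add_right (card_union_le _ _) _)) _)
      _ ≤ 8 * T := by omega

end Summit.ValiantsHypothesis.ValiantsHypothesis.Theorems.RealTauRealTauRefined
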